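import Summits.QuantumFields.QCD.Theses.SpectralDefectExtinction
import Literature.MathematicalPhysics.QuantumFieldTheory.QCD
import Summits.QuantumFields.QCD.Theorems.SpectralDefectExtinctionTipNoBindingStubPositivity
import Summits.QuantumFields.QCD.Theorems.SpectralDefectExtinctionTipNoBindingStubDiamagnetic

/-!
# Crux `WindowExtinction` (item stmt-QuantumFields-8964), line `chessboard-cold-cells`:
# Kato's inequality for the site amplitude of a colour–spinor field

Generic (definition-free) helpers of the flat-cube dichotomy `stub_geometry` (S4), in tree vocabulary.
For an `SU(3)` link field `U` on the four-torus `(ℤ/L)⁴` and a colour–spinor field `ψ`, the site amplitude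
`|ψ|(x) = √(Σ_{a,α} |ψ(x,a,α)|²)` has FREE Dirichlet energy bounded by the COVARIANT Wilson energy:

* `kato_amplitude_energy_le` :
  `Σ_{x,μ} (|ψ|(x+μ̂) − |ψ|(x))² ≤ Σ_{x,μ,a,α} |ψ(x,a,α) − Σ_b U(x,μ)_{ab} ψ(x+μ̂,b,α)|²`
  (the tree's sitewise Kato inequality `stub_diamagnetic`, summed);
* `kato_amplitude_le_two_re_wilsonDirac` : the same with right-hand side `2 Re⟨ψ, D_W(U,0,1)ψ⟩`
  (Wilson positivity, the tree's `stub_positivity`);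
* `sqrt_sum_sq_sub_sqrt_sum_sq_le`, `sqrt_sum_sub_sqrt_sum_sq_le` : the squared reverse triangle
  inequality in `ℓ²`, `(√ΣA − √ΣB)² ≤ Σ(√A − √B)²`, used to pass from site to cube amplitudes.
-/

namespace Summit.QuantumFields.QCD.Cruxes.WindowExtinction.ChessboardColdCells

open Literature.MathematicalPhysics Literature.MathematicalPhysics.QuantumLattice
  Literature.MathematicalPhysics.QuantumFieldTheory Literature.Probability.LatticeModels
open Matrix
open Summit.QuantumFields.QCD.Cruxes.TipNoBinding.PositivityNoLeakSpread (stub_positivity stub_diamagnetic)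

/-- Squared reverse triangle inequality in `ℓ²(ι, ℝ)`:
`(√(Σ u²) − √(Σ v²))² ≤ Σ (u − v)²` (discrete Cauchy–Schwarz). -/
theorem sqrt_sum_sq_sub_sqrt_sum_sq_le {ι : Type*} (s : Finset ι) (u v : ι → ℝ) :
    (Real.sqrt (∑ i ∈ s, u i ^ 2) - Real.sqrt (∑ i ∈ s, v i ^ 2)) ^ 2 ≤ ∑ i ∈ s, (u i - v i) ^ 2 := by
  have hA : 0 ≤ ∑ i ∈ s, u i ^ 2 := Finset.sum_nonneg fun _ _ => sq_nonneg _
  have hB : 0 ≤ ∑ i ∈ s, v i ^ 2 := Finset.sum_nonneg fun _ _ => sq_nonneg _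
  have hCS := Real.sum_mul_le_sqrt_mul_sqrt s u v
  have hexp : ∑ i ∈ s, (u i - v i) ^ 2 =
      ∑ i ∈ s, u i ^ 2 + ∑ i ∈ s, v i ^ 2 - 2 * ∑ i ∈ s, u i * v i := by
    rw [Finset.mul_sum, ← Finset.sum_add_distrib, ← Finset.sum_sub_distrib]
    exact Finset.sum_congr rfl fun i _ => by ring
  rw [sub_sq, Real.sq_sqrt hA, Real.sq_sqrt hB, hexp]
  nlinarith [hCS]

/-- Squared reverse triangle inequality for non-negative weights:
`(√(Σ A) − √(Σ B))² ≤ Σ (√A − √B)²` when `A, B ≥ 0` termwise. -/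
theorem sqrt_sum_sub_sqrt_sum_sq_le {ι : Type*} (s : Finset ι) (A B : ι → ℝ)
    (hA : ∀ i ∈ s, 0 ≤ A i) (hB : ∀ i ∈ s, 0 ≤ B i) :
    (Real.sqrt (∑ i ∈ s, A i) - Real.sqrt (∑ i ∈ s, B i)) ^ 2 ≤
      ∑ i ∈ s, (Real.sqrt (A i) - Real.sqrt (B i)) ^ 2 := by
  have h := sqrt_sum_sq_sub_sqrt_sum_sq_le s (fun i => Real.sqrt (A i)) (fun i => Real.sqrt (B i))
  have hA' : ∑ i ∈ s, Real.sqrt (A i) ^ 2 = ∑ i ∈ s, A i :=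
    Finset.sum_congr rfl fun i hi => Real.sq_sqrt (hA i hi)
  have hB' : ∑ i ∈ s, Real.sqrt (B i) ^ 2 = ∑ i ∈ s, B i :=
    Finset.sum_congr rfl fun i hi => Real.sq_sqrt (hB i hi)
  rw [hA', hB'] at h
  exact h

/-- **Kato's inequality for the site amplitude, energy form.**  For every `SU(3)` link field `U` on
`(ℤ/L)⁴` and every colour–spinor field `ψ`, the free Dirichlet energy of `|ψ|(x) = √(Σ_{a,α}|ψ(x,a,α)|²)`
is at most the covariant Wilson energy:
`Σ_{x,μ} (|ψ|(x+μ̂) − |ψ|(x))² ≤ Σ_{x,μ,a,α} |ψ(x,a,α) − Σ_b U(x,μ)_{ab} ψ(x+μ̂,b,α)|²`. -/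
theorem kato_amplitude_energy_le : ∀ (L : ℕ) [NeZero L] (U : GaugeConfig 4 L SU3) (ψ : QuarkIdx L → ℂ),
    ∑ x : TorusSite 4 L, ∑ μ : Fin 4,
        (Real.sqrt (∑ a : Fin 3, ∑ α : Fin 4, ‖ψ (QuantumFieldTheory.Site.shift x μ, a, α)‖ ^ 2) -
          Real.sqrt (∑ a : Fin 3, ∑ α : Fin 4, ‖ψ (x, a, α)‖ ^ 2)) ^ 2 ≤
      ∑ x : TorusSite 4 L, ∑ μ : Fin 4, ∑ a : Fin 3, ∑ α : Fin 4,
        ‖ψ (x, a, α) - ∑ b : Fin 3, (fundamentalRep (Fin 3) (U (x, μ))) a b *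
          ψ (QuantumFieldTheory.Site.shift x μ, b, α)‖ ^ 2 := by
  intro L _ U ψ
  refine Finset.sum_le_sum fun x _ => Finset.sum_le_sum fun μ _ => ?_
  refine (stub_diamagnetic L U ψ x μ).trans_eq
    (Finset.sum_congr rfl fun a _ => Finset.sum_congr rfl fun α _ => ?_)
  rw [norm_sub_rev, fundamentalRep_apply]

/-- **Kato's inequality for the site amplitude, operator form.**  With `D = D_W(U,0,1)` the massless
`r = 1` Wilson–Dirac operator: `Σ_{x,μ} (|ψ|(x+μ̂) − |ψ|(x))² ≤ 2 Re⟨ψ, Dψ⟩`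
(Wilson positivity `stub_positivity` + the sitewise Kato inequality `stub_diamagnetic`). -/
theorem kato_amplitude_le_two_re_wilsonDirac (L : ℕ) [NeZero L] (U : GaugeConfig 4 L SU3)
    (ψ : QuarkIdx L → ℂ) :
    ∑ x : TorusSite 4 L, ∑ μ : Fin 4,
        (Real.sqrt (∑ a : Fin 3, ∑ α : Fin 4, ‖ψ (QuantumFieldTheory.Site.shift x μ, a, α)‖ ^ 2) -
          Real.sqrt (∑ a : Fin 3, ∑ α : Fin 4, ‖ψ (x, a, α)‖ ^ 2)) ^ 2 ≤
      2 * (star ψ ⬝ᵥ (wilsonDirac (fundamentalRep (Fin 3)) U 0 1 *ᵥ ψ)).re := by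
  rw [stub_positivity L U ψ, ← mul_assoc, show (2 : ℝ) * (1 / 2) = 1 by norm_num, one_mul]
  exact Finset.sum_le_sum fun x _ => Finset.sum_le_sum fun μ _ => stub_diamagnetic L U ψ x μ

end Summit.QuantumFields.QCD.Cruxes.WindowExtinction.ChessboardColdCells
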